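import Summits.ResolutionOfSingularities.ResolutionOfSingularities.Theorems.PurelyInseparableDim4ResConeCInfGameExact
import HarnessLib
import HarnessLib.Audit.Tags

/-!
# Purely inseparable four-folds — the C∞ GAME, WINDOW form FOR EVERY FAMILY CONSTANT: after a letter change `λμ` a legal
# doubly-flagged play lasts at most `4C + 2` further letters when every monomial has `c ≤ C`
# (cell `res-dim4-pi`, K2(p) lane, rung-1 power-cone line «light pair of TAIL(p, p−1, 3) ∀ p»: the FINITE game half)

[OURS · counted 0 · cell `res-dim4-pi` · K2(p) lane (holder res-dim4-p-12 g5); the `C = 3` instance with the hand-optimised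
window `9` is res-dim4-p-9 g3's `…ResConeCInfGameWindow` (`Window.no_play_after_change`), whose clockwork this file repeats
with the family constant as a PARAMETER; interface agreed with res-dim4-typ-1 g5 (window half, `virtual_iterate (p)` with `T` a
parameter) on the bus 2026-08-29 10:16Z; seat res-dim4-p-3 g5.]  Nothing here proves K2(p) for any `p`, any TAIL(p, p−1, 3),
`NoIsolatedTrap p p`, the Cossart–Jannsen–Saito theorem or resolution of singularities in dimension ≥ 4 / characteristic `p`
— NOT proved.  AI kernel work, weaker than expert review.  Pure combinatorics of OUR frame's game; kills nothing by itself.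

Monomials `(c, a, b, e)`; word `x : ℕ → Bool` (`true = λ`) with the LETTER CHANGE `x 0 = λ`, `x 1 = μ`; λ-STEP
`(c,a,b,e) ↦ (c, a+b+e−c, b, e)`, μ-STEP the mirror; DEAD `c ≤ a + e ∧ c ≤ b + e`; λ-WITNESS `b + e + 1 ≤ c`, μ-WITNESS
`a + e + 1 ≤ c`; LEGAL(λ) `2c ≤ a + 2b + 2e`, LEGAL(μ) `2c ≤ 2a + b + 2e`.  HORIZON `T`: legality at steps `0 … T`, forward
laws for live images at steps `0 … T−1`, backward law at steps `0 … T−3`, both flags at the states `2 … T−2`, `c ≤ C`.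
* §1 `double_dies` — the ONE new lemma: a DOUBLE witness (`a + e < c ∧ b + e < c`) present at `t` with `t + a + b ≤ T` is
  impossible: its forward images stay present and double while `a + b` drops at every step, and legality at a double monomial
  needs `a ≥ 2` (λ) resp. `b ≥ 2` (μ).  Hence `lambda_witness_L'`: a λ-witness at `t` with `t + 2C ≤ T + 2` lies in `c ≤ a + e`
  (at `C = 3` this was `double_blocks`, one step).
* §2 the p-9 clockwork with `c ≤ C`: `lambda_step_bound'`, `lambda_witness_pre'`, `after_mu_bound'`, `after_mu_count'`
  («`#λ since the μ-step + a + 2e + 1 ≤ 2c`»), `few_lambda_after_mu'` (at most `C − 1` letters λ in any stretch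
  `[t, t+k)` with `2 ≤ t`, `t + k + 2C ≤ T + 1`), the `Mirror'` namespace, `few_mu_after_lambda'`.
* §3 **`no_play_after_change_of_le (C T) (hC1 : 1 ≤ C) (hT : 4 * C + 2 ≤ T)`** — contradiction: among the `2C − 1` steps `2 … 2C` at most
  `C − 1` are λ and at most `C − 1` are μ.  (`L(C) = 4C + 2`; `L(3) = 14 ≥ 9`: not tight, the window half does not care.)
[cite: CossartJannsenSaito2020, Thm. 3.14]
bears_on: LADDER-RESOLUTION:D157-DOOR2 (res-dim4-pi · K2(p) · power cones · C∞ window game every C).  Supports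
stmt-ResolutionOfSingularities-16155 (helper).
-/

set_option linter.dupNamespace false -- mandated namespace of this single-conjunct summit

namespace Summit.ResolutionOfSingularities.ResolutionOfSingularities.Theorems.PIDim4

namespace ResCone

namespace CInfGame

namespace WindowPrime

open Finset

variable {x : ℕ → Bool} {P : ℕ → ℕ × ℕ × ℕ × ℕ → Prop} {C T : ℕ}

/-! ## §1 Double witnesses die forward -/

/-- **A double witness cannot be present early**: if `(c, a, b, e)` with `a + e < c`, `b + e < c` is present at `t` and
`t + a + b ≤ T`, the play is not legal up to `T` (induction on `a + b`: a legal step at a double monomial needs `a ≥ 2` (λ) or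
`b ≥ 2` (μ), and maps it to a present double monomial with smaller `a + b`). [OURS] [folklore] -/
theorem double_dies
    (hfwdL : ∀ t c a b e, t + 1 ≤ T → P t (c, a, b, e) → x t = true →
      ¬ (c ≤ a + b + e - c + e ∧ c ≤ b + e) → P (t + 1) (c, a + b + e - c, b, e))
    (hfwdM : ∀ t c a b e, t + 1 ≤ T → P t (c, a, b, e) → x t = false →
      ¬ (c ≤ a + e ∧ c ≤ a + b + e - c + e) → P (t + 1) (c, a, a + b + e - c, e))
    (hlegL : ∀ t c a b e, t ≤ T → P t (c, a, b, e) → x t = true → 2 * c ≤ a + 2 * b + 2 * e)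
    (hlegM : ∀ t c a b e, t ≤ T → P t (c, a, b, e) → x t = false → 2 * c ≤ 2 * a + b + 2 * e) :
    ∀ n t c a b e, a + b ≤ n → t + a + b ≤ T → P t (c, a, b, e) → a + e + 1 ≤ c → b + e + 1 ≤ c → False := by
  intro n
  induction n with
  | zero =>
    intro t c a b e hn ht hm ha hb
    cases hx : x t with
    | true => have := hlegL t c a b e (by omega) hm hx; omega
    | false => have := hlegM t c a b e (by omega) hm hx; omega
  | succ n ih =>
    intro t c a b e hn ht hm ha hb
    cases hx : x t with
    | true =>
      have l := hlegL t c a b e (by omega) hm hx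
      have hP := hfwdL t c a b e (by omega) hm hx (by omega)
      exact ih (t + 1) c (a + b + e - c) b e (by omega) (by omega) hP (by omega) hb
    | false =>
      have l := hlegM t c a b e (by omega) hm hx
      have hP := hfwdM t c a b e (by omega) hm hx (by omega)
      exact ih (t + 1) c a (a + b + e - c) e (by omega) (by omega) hP ha (by omega)

/-- A λ-witness with `c ≤ C` present at `t` with `t + 2C ≤ T + 2` lies in `c ≤ a + e`. [OURS] [folklore] -/
theorem lambda_witness_L'
    (hC : ∀ t c a b e, P t (c, a, b, e) → c ≤ C)
    (hfwdL : ∀ t c a b e, t + 1 ≤ T → P t (c, a, b, e) → x t = true →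
      ¬ (c ≤ a + b + e - c + e ∧ c ≤ b + e) → P (t + 1) (c, a + b + e - c, b, e))
    (hfwdM : ∀ t c a b e, t + 1 ≤ T → P t (c, a, b, e) → x t = false →
      ¬ (c ≤ a + e ∧ c ≤ a + b + e - c + e) → P (t + 1) (c, a, a + b + e - c, e))
    (hlegL : ∀ t c a b e, t ≤ T → P t (c, a, b, e) → x t = true → 2 * c ≤ a + 2 * b + 2 * e)
    (hlegM : ∀ t c a b e, t ≤ T → P t (c, a, b, e) → x t = false → 2 * c ≤ 2 * a + b + 2 * e)
    {t c a b e : ℕ} (ht : t + 2 * C ≤ T + 2) (hm : P t (c, a, b, e)) (hb : b + e + 1 ≤ c) : c ≤ a + e := by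
  by_contra h
  have hc := hC t c a b e hm
  exact double_dies hfwdL hfwdM hlegL hlegM (a + b) t c a b e le_rfl (by omega) hm (by omega) hb

/-! ## §2 The clockwork with `c ≤ C` -/

/-- **λ-step bound**: at a λ-step at `t` (`t + 2C ≤ T + 1`) every present λ-witness has `2c ≤ a + b + 2e`. [OURS] [folklore] -/
theorem lambda_step_bound'
    (hC : ∀ t c a b e, P t (c, a, b, e) → c ≤ C)
    (hfwdL : ∀ t c a b e, t + 1 ≤ T → P t (c, a, b, e) → x t = true →
      ¬ (c ≤ a + b + e - c + e ∧ c ≤ b + e) → P (t + 1) (c, a + b + e - c, b, e))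
    (hfwdM : ∀ t c a b e, t + 1 ≤ T → P t (c, a, b, e) → x t = false →
      ¬ (c ≤ a + e ∧ c ≤ a + b + e - c + e) → P (t + 1) (c, a, a + b + e - c, e))
    (hlegL : ∀ t c a b e, t ≤ T → P t (c, a, b, e) → x t = true → 2 * c ≤ a + 2 * b + 2 * e)
    (hlegM : ∀ t c a b e, t ≤ T → P t (c, a, b, e) → x t = false → 2 * c ≤ 2 * a + b + 2 * e)
    {t c a b e : ℕ} (ht : t + 2 * C ≤ T + 1) (hx : x t = true) (hm : P t (c, a, b, e)) (hb : b + e + 1 ≤ c) :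
    2 * c ≤ a + b + 2 * e := by
  have hc := hC t c a b e hm
  have ha := lambda_witness_L' hC hfwdL hfwdM hlegL hlegM (by omega) hm hb
  have hP := hfwdL t c a b e (by omega) hm hx (by omega)
  have := lambda_witness_L' hC hfwdL hfwdM hlegL hlegM (by omega) hP hb
  omega

/-- **Predecessor of a λ-witness** (child at `t + 1`, `t + 2C ≤ T`, `t + 3 ≤ T`): the image of a present λ-witness with
`c ≤ a₀ + e`. [OURS] [folklore] -/
theorem lambda_witness_pre'
    (hC : ∀ t c a b e, P t (c, a, b, e) → c ≤ C)
    (hfwdL : ∀ t c a b e, t + 1 ≤ T → P t (c, a, b, e) → x t = true →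
      ¬ (c ≤ a + b + e - c + e ∧ c ≤ b + e) → P (t + 1) (c, a + b + e - c, b, e))
    (hfwdM : ∀ t c a b e, t + 1 ≤ T → P t (c, a, b, e) → x t = false →
      ¬ (c ≤ a + e ∧ c ≤ a + b + e - c + e) → P (t + 1) (c, a, a + b + e - c, e))
    (hlegL : ∀ t c a b e, t ≤ T → P t (c, a, b, e) → x t = true → 2 * c ≤ a + 2 * b + 2 * e)
    (hlegM : ∀ t c a b e, t ≤ T → P t (c, a, b, e) → x t = false → 2 * c ≤ 2 * a + b + 2 * e)
    (hevol : ∀ t c a b e, t + 3 ≤ T → P (t + 1) (c, a, b, e) → (c ≤ a + e ∧ c ≤ b + e) ∨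
      ∃ a₀ b₀, P t (c, a₀, b₀, e) ∧ ((x t = true ∧ a = a₀ + b₀ + e - c ∧ b = b₀) ∨
        (x t = false ∧ a = a₀ ∧ b = a₀ + b₀ + e - c)))
    {t c a b e : ℕ} (ht : t + 2 * C ≤ T) (ht3 : t + 3 ≤ T) (hm : P (t + 1) (c, a, b, e)) (hb : b + e + 1 ≤ c) :
    ∃ a₀ b₀, P t (c, a₀, b₀, e) ∧ b₀ + e + 1 ≤ c ∧ c ≤ a₀ + e ∧
      ((x t = true ∧ a = a₀ + b₀ + e - c ∧ b = b₀) ∨ (x t = false ∧ a = a₀ ∧ b = a₀ + b₀ + e - c)) := by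
  rcases hevol t c a b e ht3 hm with hdead | ⟨a₀, b₀, hm₀, hcase⟩
  · exfalso; omega
  · rcases hcase with ⟨hx, ha, hb0⟩ | ⟨hx, ha, hb0⟩
    · have hb₀ : b₀ + e + 1 ≤ c := by omega
      exact ⟨a₀, b₀, hm₀, hb₀, lambda_witness_L' hC hfwdL hfwdM hlegL hlegM (by omega) hm₀ hb₀, Or.inl ⟨hx, ha, hb0⟩⟩
    · have haL : c ≤ a₀ + e := by
        have := lambda_witness_L' hC hfwdL hfwdM hlegL hlegM (t := t + 1) (by omega) hm hb
        omega
      have hb₀ : b₀ + e + 1 ≤ c := by omega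
      exact ⟨a₀, b₀, hm₀, hb₀, haL, Or.inr ⟨hx, ha, hb0⟩⟩

/-- **After a μ-step at `s₁` every λ-witness has `a + 2e + 1 ≤ 2c`** (states `s₁ + 1 + k` with `s₁ + k + 2C ≤ T`,
`s₁ + k + 3 ≤ T`). [OURS] [folklore] -/
theorem after_mu_bound'
    (hC : ∀ t c a b e, P t (c, a, b, e) → c ≤ C)
    (hfwdL : ∀ t c a b e, t + 1 ≤ T → P t (c, a, b, e) → x t = true →
      ¬ (c ≤ a + b + e - c + e ∧ c ≤ b + e) → P (t + 1) (c, a + b + e - c, b, e))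
    (hfwdM : ∀ t c a b e, t + 1 ≤ T → P t (c, a, b, e) → x t = false →
      ¬ (c ≤ a + e ∧ c ≤ a + b + e - c + e) → P (t + 1) (c, a, a + b + e - c, e))
    (hlegL : ∀ t c a b e, t ≤ T → P t (c, a, b, e) → x t = true → 2 * c ≤ a + 2 * b + 2 * e)
    (hlegM : ∀ t c a b e, t ≤ T → P t (c, a, b, e) → x t = false → 2 * c ≤ 2 * a + b + 2 * e)
    (hevol : ∀ t c a b e, t + 3 ≤ T → P (t + 1) (c, a, b, e) → (c ≤ a + e ∧ c ≤ b + e) ∨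
      ∃ a₀ b₀, P t (c, a₀, b₀, e) ∧ ((x t = true ∧ a = a₀ + b₀ + e - c ∧ b = b₀) ∨
        (x t = false ∧ a = a₀ ∧ b = a₀ + b₀ + e - c)))
    {s₁ : ℕ} (hs : x s₁ = false) (k : ℕ) (hk : s₁ + k + 2 * C ≤ T) (hk3 : s₁ + k + 3 ≤ T) :
    ∀ c a b e, P (s₁ + 1 + k) (c, a, b, e) → b + e + 1 ≤ c → a + 2 * e + 1 ≤ 2 * c := by
  induction k with
  | zero =>
    intro c a b e hm hb
    obtain ⟨a₀, b₀, _, hb₀, ha₀, hcase⟩ :=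
      lambda_witness_pre' hC hfwdL hfwdM hlegL hlegM hevol (by omega) (by omega) hm hb
    rcases hcase with ⟨hx, _, _⟩ | ⟨_, ha, hb'⟩
    · rw [hs] at hx; exact absurd hx (by decide)
    · omega
  | succ k ih =>
    intro c a b e hm hb
    rw [show s₁ + 1 + (k + 1) = s₁ + 1 + k + 1 from rfl] at hm
    obtain ⟨a₀, b₀, hm₀, hb₀, ha₀, hcase⟩ :=
      lambda_witness_pre' hC hfwdL hfwdM hlegL hlegM hevol (by omega) (by omega) hm hb
    have := ih (by omega) (by omega) c a₀ b₀ e hm₀ hb₀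
    rcases hcase with ⟨_, ha, hb'⟩ | ⟨_, ha, hb'⟩ <;> omega

/-- **Counting form**: from a time `t` after the μ-step, a λ-witness present at `t + k` (`t + k + 2C ≤ T + 1`, `t + k + 2 ≤ T`)
satisfies `#{i < k : x (t + i) = λ} + a + 2e + 1 ≤ 2c`. [OURS] [folklore] -/
theorem after_mu_count'
    (hC : ∀ t c a b e, P t (c, a, b, e) → c ≤ C)
    (hfwdL : ∀ t c a b e, t + 1 ≤ T → P t (c, a, b, e) → x t = true →
      ¬ (c ≤ a + b + e - c + e ∧ c ≤ b + e) → P (t + 1) (c, a + b + e - c, b, e))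
    (hfwdM : ∀ t c a b e, t + 1 ≤ T → P t (c, a, b, e) → x t = false →
      ¬ (c ≤ a + e ∧ c ≤ a + b + e - c + e) → P (t + 1) (c, a, a + b + e - c, e))
    (hlegL : ∀ t c a b e, t ≤ T → P t (c, a, b, e) → x t = true → 2 * c ≤ a + 2 * b + 2 * e)
    (hlegM : ∀ t c a b e, t ≤ T → P t (c, a, b, e) → x t = false → 2 * c ≤ 2 * a + b + 2 * e)
    (hevol : ∀ t c a b e, t + 3 ≤ T → P (t + 1) (c, a, b, e) → (c ≤ a + e ∧ c ≤ b + e) ∨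
      ∃ a₀ b₀, P t (c, a₀, b₀, e) ∧ ((x t = true ∧ a = a₀ + b₀ + e - c ∧ b = b₀) ∨
        (x t = false ∧ a = a₀ ∧ b = a₀ + b₀ + e - c)))
    {s₁ t : ℕ} (hs : x s₁ = false) (hst : s₁ + 1 ≤ t) (k : ℕ) (hk : t + k + 2 * C ≤ T + 1) (hk3 : t + k + 2 ≤ T) :
    ∀ c a b e, P (t + k) (c, a, b, e) → b + e + 1 ≤ c →
      (∑ i ∈ range k, (x (t + i)).toNat) + a + 2 * e + 1 ≤ 2 * c := by
  induction k with
  | zero =>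
    intro c a b e hm hb
    rw [show t + 0 = s₁ + 1 + (t - (s₁ + 1)) from by omega] at hm
    have := after_mu_bound' hC hfwdL hfwdM hlegL hlegM hevol hs _ (by omega) (by omega) c a b e hm hb
    simpa using this
  | succ k ih =>
    intro c a b e hm hb
    rw [show t + (k + 1) = t + k + 1 from rfl] at hm
    obtain ⟨a₀, b₀, hm₀, hb₀, ha₀, hcase⟩ :=
      lambda_witness_pre' hC hfwdL hfwdM hlegL hlegM hevol (by omega) (by omega) hm hb
    have := ih (by omega) (by omega) c a₀ b₀ e hm₀ hb₀
    rw [sum_range_succ]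
    rcases hcase with ⟨hx, ha, hb'⟩ | ⟨hx, ha, hb'⟩
    · rw [hx, Bool.toNat_true]; omega
    · rw [hx, Bool.toNat_false]; omega

/-- **After a μ-step at most `C − 1` further letters λ inside the window**: `#{i < k : x (t + i) = λ} + 1 ≤ C` for `t` after
the μ-step, `2 ≤ t`, `t + k + 2C ≤ T + 1`, `t + k + 2 ≤ T`, flags at the states `2 … T − 2`. [OURS] [folklore] -/
theorem few_lambda_after_mu'
    (hC : ∀ t c a b e, P t (c, a, b, e) → c ≤ C)
    (hfwdL : ∀ t c a b e, t + 1 ≤ T → P t (c, a, b, e) → x t = true →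
      ¬ (c ≤ a + b + e - c + e ∧ c ≤ b + e) → P (t + 1) (c, a + b + e - c, b, e))
    (hfwdM : ∀ t c a b e, t + 1 ≤ T → P t (c, a, b, e) → x t = false →
      ¬ (c ≤ a + e ∧ c ≤ a + b + e - c + e) → P (t + 1) (c, a, a + b + e - c, e))
    (hlegL : ∀ t c a b e, t ≤ T → P t (c, a, b, e) → x t = true → 2 * c ≤ a + 2 * b + 2 * e)
    (hlegM : ∀ t c a b e, t ≤ T → P t (c, a, b, e) → x t = false → 2 * c ≤ 2 * a + b + 2 * e)
    (hevol : ∀ t c a b e, t + 3 ≤ T → P (t + 1) (c, a, b, e) → (c ≤ a + e ∧ c ≤ b + e) ∨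
      ∃ a₀ b₀, P t (c, a₀, b₀, e) ∧ ((x t = true ∧ a = a₀ + b₀ + e - c ∧ b = b₀) ∨
        (x t = false ∧ a = a₀ ∧ b = a₀ + b₀ + e - c)))
    (hflagL : ∀ t, 2 ≤ t → t + 2 ≤ T → ∃ c a b e, P t (c, a, b, e) ∧ b + e + 1 ≤ c)
    {s₁ t : ℕ} (hs : x s₁ = false) (hst : s₁ + 1 ≤ t) (h2 : 2 ≤ t) (k : ℕ) (hk : t + k + 2 * C ≤ T + 1)
    (hk2 : t + k + 2 ≤ T) :
    (∑ i ∈ range k, (x (t + i)).toNat) + 1 ≤ C := by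
  induction k with
  | zero =>
    obtain ⟨c, a, b, e, hm, hb⟩ := hflagL t h2 (by omega)
    have := hC _ c a b e hm
    simp; omega
  | succ k ih =>
    rw [sum_range_succ]
    cases hx : x (t + k) with
    | false => rw [Bool.toNat_false]; have := ih (by omega) (by omega); omega
    | true =>
      rw [Bool.toNat_true]
      obtain ⟨c, a, b, e, hm, hb⟩ := hflagL (t + k) (by omega) (by omega)
      have h1 := after_mu_count' hC hfwdL hfwdM hlegL hlegM hevol hs hst k (by omega) (by omega) c a b e hm hb
      have h2 := lambda_step_bound' hC hfwdL hfwdM hlegL hlegM (by omega) hx hm hb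
      have h3 := hC _ c a b e hm
      omega

/-! The mirror `a ↔ b`, `λ ↔ μ`. -/

namespace Mirror'

/-- Mirror forward law (λ' from μ). [folklore] -/
theorem hfwdL
    (hfwdM : ∀ t c a b e, t + 1 ≤ T → P t (c, a, b, e) → x t = false →
      ¬ (c ≤ a + e ∧ c ≤ a + b + e - c + e) → P (t + 1) (c, a, a + b + e - c, e)) :
    ∀ t c a b e, t + 1 ≤ T → P t (c, b, a, e) → (!x t) = true →
      ¬ (c ≤ a + b + e - c + e ∧ c ≤ b + e) → P (t + 1) (c, b, a + b + e - c, e) := by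
  intro t c a b e ht hm hx hnd
  have hx' : x t = false := by simpa using hx
  have h := hfwdM t c b a e ht hm hx' (by rw [Nat.add_comm b a]; omega)
  rw [Nat.add_comm b a] at h
  exact h

/-- Mirror forward law (μ' from λ). [folklore] -/
theorem hfwdM
    (hfwdL : ∀ t c a b e, t + 1 ≤ T → P t (c, a, b, e) → x t = true →
      ¬ (c ≤ a + b + e - c + e ∧ c ≤ b + e) → P (t + 1) (c, a + b + e - c, b, e)) :
    ∀ t c a b e, t + 1 ≤ T → P t (c, b, a, e) → (!x t) = false →
      ¬ (c ≤ a + e ∧ c ≤ a + b + e - c + e) → P (t + 1) (c, a + b + e - c, a, e) := by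
  intro t c a b e ht hm hx hnd
  have hx' : x t = true := by simpa using hx
  have h := hfwdL t c b a e ht hm hx' (by rw [Nat.add_comm b a]; omega)
  rw [Nat.add_comm b a] at h
  exact h

/-- Mirror backward law. [folklore] -/
theorem hevol
    (hevol : ∀ t c a b e, t + 3 ≤ T → P (t + 1) (c, a, b, e) → (c ≤ a + e ∧ c ≤ b + e) ∨
      ∃ a₀ b₀, P t (c, a₀, b₀, e) ∧ ((x t = true ∧ a = a₀ + b₀ + e - c ∧ b = b₀) ∨
        (x t = false ∧ a = a₀ ∧ b = a₀ + b₀ + e - c))) :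
    ∀ t c a b e, t + 3 ≤ T → P (t + 1) (c, b, a, e) → (c ≤ a + e ∧ c ≤ b + e) ∨
      ∃ a₀ b₀, P t (c, b₀, a₀, e) ∧ (((!x t) = true ∧ a = a₀ + b₀ + e - c ∧ b = b₀) ∨
        ((!x t) = false ∧ a = a₀ ∧ b = a₀ + b₀ + e - c)) := by
  intro t c a b e ht hm
  rcases hevol t c b a e ht hm with hdead | ⟨a₁, b₁, hm₁, hcase⟩
  · exact Or.inl ⟨hdead.2, hdead.1⟩
  · refine Or.inr ⟨b₁, a₁, hm₁, ?_⟩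
    rcases hcase with ⟨hx, h1, h2⟩ | ⟨hx, h1, h2⟩
    · right; refine ⟨by simp [hx], h2, ?_⟩; rw [h1, Nat.add_comm a₁ b₁]
    · left; refine ⟨by simp [hx], ?_, h1⟩; rw [h2, Nat.add_comm a₁ b₁]

/-- Mirror legality (λ' from μ). [folklore] -/
theorem hlegL (hlegM : ∀ t c a b e, t ≤ T → P t (c, a, b, e) → x t = false → 2 * c ≤ 2 * a + b + 2 * e) :
    ∀ t c a b e, t ≤ T → P t (c, b, a, e) → (!x t) = true → 2 * c ≤ a + 2 * b + 2 * e := by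
  intro t c a b e ht hm hx
  have hx' : x t = false := by simpa using hx
  have := hlegM t c b a e ht hm hx'; omega

/-- Mirror legality (μ' from λ). [folklore] -/
theorem hlegM (hlegL : ∀ t c a b e, t ≤ T → P t (c, a, b, e) → x t = true → 2 * c ≤ a + 2 * b + 2 * e) :
    ∀ t c a b e, t ≤ T → P t (c, b, a, e) → (!x t) = false → 2 * c ≤ 2 * a + b + 2 * e := by
  intro t c a b e ht hm hx
  have hx' : x t = true := by simpa using hx
  have := hlegL t c b a e ht hm hx'; omega

/-- Mirror flag (λ' from μ). [folklore] -/
theorem hflagL (hflagM : ∀ t, 2 ≤ t → t + 2 ≤ T → ∃ c a b e, P t (c, a, b, e) ∧ a + e + 1 ≤ c) :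
    ∀ t, 2 ≤ t → t + 2 ≤ T → ∃ c a b e, P t (c, b, a, e) ∧ b + e + 1 ≤ c := by
  intro t h2 h6
  obtain ⟨c, a, b, e, hm, ha⟩ := hflagM t h2 h6
  exact ⟨c, b, a, e, hm, ha⟩

end Mirror'

/-- **After a λ-step at most `C − 1` further letters μ inside the window** (mirror). [OURS] [folklore] -/
theorem few_mu_after_lambda'
    (hC : ∀ t c a b e, P t (c, a, b, e) → c ≤ C)
    (hfwdL : ∀ t c a b e, t + 1 ≤ T → P t (c, a, b, e) → x t = true →
      ¬ (c ≤ a + b + e - c + e ∧ c ≤ b + e) → P (t + 1) (c, a + b + e - c, b, e))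
    (hfwdM : ∀ t c a b e, t + 1 ≤ T → P t (c, a, b, e) → x t = false →
      ¬ (c ≤ a + e ∧ c ≤ a + b + e - c + e) → P (t + 1) (c, a, a + b + e - c, e))
    (hlegL : ∀ t c a b e, t ≤ T → P t (c, a, b, e) → x t = true → 2 * c ≤ a + 2 * b + 2 * e)
    (hlegM : ∀ t c a b e, t ≤ T → P t (c, a, b, e) → x t = false → 2 * c ≤ 2 * a + b + 2 * e)
    (hevol : ∀ t c a b e, t + 3 ≤ T → P (t + 1) (c, a, b, e) → (c ≤ a + e ∧ c ≤ b + e) ∨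
      ∃ a₀ b₀, P t (c, a₀, b₀, e) ∧ ((x t = true ∧ a = a₀ + b₀ + e - c ∧ b = b₀) ∨
        (x t = false ∧ a = a₀ ∧ b = a₀ + b₀ + e - c)))
    (hflagM : ∀ t, 2 ≤ t → t + 2 ≤ T → ∃ c a b e, P t (c, a, b, e) ∧ a + e + 1 ≤ c)
    {s₁ t : ℕ} (hs : x s₁ = true) (hst : s₁ + 1 ≤ t) (h2 : 2 ≤ t) (k : ℕ) (hk : t + k + 2 * C ≤ T + 1)
    (hk2 : t + k + 2 ≤ T) :
    (∑ i ∈ range k, (!x (t + i)).toNat) + 1 ≤ C :=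
  few_lambda_after_mu' (x := fun s => !x s) (P := fun t m => P t (m.1, m.2.2.1, m.2.1, m.2.2.2))
    (CInfGame.Exact.Mirror.hC hC) (Mirror'.hfwdL hfwdM) (Mirror'.hfwdM hfwdL) (Mirror'.hlegL hlegM) (Mirror'.hlegM hlegL)
    (Mirror'.hevol hevol) (Mirror'.hflagL hflagM) (by simp [hs]) hst h2 k hk hk2

/-! ## §3 The window theorem for every family constant -/

/-- **THE WINDOW THEOREM FOR EVERY FAMILY CONSTANT: a letter change `λμ` is followed by at most `4C` legal doubly-flagged
letters.**  Time re-indexed at the change (`x 0 = λ`, `x 1 = μ`); `1 ≤ C`, horizon `T ≥ 4C + 2`; for ANY supports: LEGAL at steps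
`0 … T`, the FORWARD laws for live images at steps `0 … T−1`, the BACKWARD law at steps `0 … T−3`, both isolation FLAGS at the
states `2 … T−2`, family constants `≤ C` — contradiction (among the `2C − 1` steps `2 … 2C` at most `C − 1` are λ and at most
`C − 1` are μ). [OURS] [folklore] -/
theorem no_play_after_change_of_le (C T : ℕ) (hC1 : 1 ≤ C) (hT : 4 * C + 2 ≤ T) (x : ℕ → Bool)
    (P : ℕ → ℕ × ℕ × ℕ × ℕ → Prop)
    (hx0 : x 0 = true) (hx1 : x 1 = false)
    (hC : ∀ t c a b e, P t (c, a, b, e) → c ≤ C)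
    (hfwdL : ∀ t c a b e, t + 1 ≤ T → P t (c, a, b, e) → x t = true →
      ¬ (c ≤ a + b + e - c + e ∧ c ≤ b + e) → P (t + 1) (c, a + b + e - c, b, e))
    (hfwdM : ∀ t c a b e, t + 1 ≤ T → P t (c, a, b, e) → x t = false →
      ¬ (c ≤ a + e ∧ c ≤ a + b + e - c + e) → P (t + 1) (c, a, a + b + e - c, e))
    (hlegL : ∀ t c a b e, t ≤ T → P t (c, a, b, e) → x t = true → 2 * c ≤ a + 2 * b + 2 * e)
    (hlegM : ∀ t c a b e, t ≤ T → P t (c, a, b, e) → x t = false → 2 * c ≤ 2 * a + b + 2 * e)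
    (hevol : ∀ t c a b e, t + 3 ≤ T → P (t + 1) (c, a, b, e) → (c ≤ a + e ∧ c ≤ b + e) ∨
      ∃ a₀ b₀, P t (c, a₀, b₀, e) ∧ ((x t = true ∧ a = a₀ + b₀ + e - c ∧ b = b₀) ∨
        (x t = false ∧ a = a₀ ∧ b = a₀ + b₀ + e - c)))
    (hflagL : ∀ t, 2 ≤ t → t + 2 ≤ T → ∃ c a b e, P t (c, a, b, e) ∧ b + e + 1 ≤ c)
    (hflagM : ∀ t, 2 ≤ t → t + 2 ≤ T → ∃ c a b e, P t (c, a, b, e) ∧ a + e + 1 ≤ c) : False := by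
  have h1 := few_lambda_after_mu' hC hfwdL hfwdM hlegL hlegM hevol hflagL hx1 (t := 2) (by omega) le_rfl
    (2 * C - 1) (by omega) (by omega)
  have h2 := few_mu_after_lambda' hC hfwdL hfwdM hlegL hlegM hevol hflagM hx0 (t := 2) (by omega) le_rfl
    (2 * C - 1) (by omega) (by omega)
  have hsum : ∀ k, (∑ i ∈ range k, (x (2 + i)).toNat) + (∑ i ∈ range k, (!x (2 + i)).toNat) = k := by
    intro k
    induction k with
    | zero => simp
    | succ k ih =>
      rw [sum_range_succ, sum_range_succ]
      cases x (2 + k) <;> simp <;> omega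
  have := hsum (2 * C - 1)
  omega

end WindowPrime

end CInfGame

end ResCone

end Summit.ResolutionOfSingularities.ResolutionOfSingularities.Theorems.PIDim4
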